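import Summits.BirchSwinnertonDyer.BirchSwinnertonDyer.Theorems.EisensteinPrimesGoodLatticeBDPValueOfNamedFactsV33N
import Summits.BirchSwinnertonDyer.BirchSwinnertonDyer.Theorems.EisensteinPrimesGoodLatticeAnacongOfCGLSProofOfDatum
import Summits.BirchSwinnertonDyer.BirchSwinnertonDyer.Theorems.EisensteinPrimesFullDescentDatumOddPrime
import HarnessLib

/-!
# Crux `GoodLatticeBDPValue` (stmt-BirchSwinnertonDyer-19032), line `halves`: THE CRUX BY NAME FROM SEVEN LITERATURE NAMED FACTS —
# research 7 · PREPRINT-GRADE 0 · textbook 0; the by-name closure of the post-V33N surface (no Keller–Yin statement is read)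

Cell `bsd-eis` (run/shared/lean/pub/bsd-eis/), width seat `bsd-line-x1-p1-w2` gen 27. `--supports stmt-BirchSwinnertonDyer-19032`
(helper; closes nothing by itself).  PRE-STAGED for the LEAD's next registry touch (a v34 of `Cruxes/GoodLatticeBDPValue/Lines/halves.lean`),
exactly as `…OfNamedFactsV33P` (width seat w5 gen 12) was pre-staged for v33N.

v33N (`…OfNamedFactsV33N.goodLatticeBDPValue_of_namedFacts₃₃ₙ`, LEAD g11): the crux BY NAME from SIX names — research 5 in ONE cite hypothesis
`stub_printInputs` (CGLS 2022 proof of Thm. 4.2.2, Thm. 5.1.3 (disc), Thm. 2.1.2; Bleher et al. 2020 Thm. 3.3.1; de Shalit 1987 II.6.4) and ONE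
CONTENT hypothesis, the preprint-grade stub 3a-A `KellerYin2024.thm222_anacong_goodLattice_of_fullDescentDatum` (Keller–Yin arXiv:2402.12781v2
Thm. 2.2.2 at a full-descent datum).  Width seat -w2 gen 26 proved 3a-A BY NAME in the kernel from TWO PUBLISHED named facts
(`GoodLatticeAnacongOfCGLSProofOfDatum.thm222_anacong_goodLattice_of_fullDescentDatum_of_proofThm221_of_thmI`, p761499):
`CastellaGrossiLeeSkinner2022.proofThm221_congruence_of_fullEisensteinDescent` (CGLS 2022, Invent. Math. 227, the PROOF of Thm. 2.2.1 from the
Eisenstein congruence (eq:cong-mf), entered through Kriz 2016 Def. 31 / Rem. 32 full descent; Literature p759553, accepted by review) and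
`Hida2010MuInvariant.thmI_mu_katzLFunction_eq_zero` (Hida 2010, Ann. of Math. 172, Thm. I).  Composing the two:

* `thm222_anacong_goodLattice_OPEN_of_proofThm221_of_thmI` — Keller–Yin's every-odd-`p` [AN] statement `KellerYin2024.thm222_anacong_goodLattice_OPEN`
  (a PREPRINT claim carried as a named `Prop`) FOLLOWS from the two published facts (3a-A from them, then width seat w6 gen 8's
  `FullDescentDatumOddPrime.thm222_anacong_goodLattice_OPEN_of_fullDescentDatum`: the full-descent datum exists at every odd good Eisenstein prime);
* `thm308_imc2_bdpValue_goodLattice_OPEN_of_namedFacts₃₄` — the Literature `Prop` `KellerYin2024.thm308_imc2_bdpValue_goodLattice_OPEN`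
  (Keller–Yin Thm. 3.0.8 (IMC2) for the good lattice at an anomalous prime, read at `𝟙` with the BDP formula — the crux's signature, and the
  body of BOTH route decls `Theses.EisensteinPrimes.GoodLatticeBDPValue` / `Theses.RealTwistEisenstein.GoodLatticeBDPValue`) from the SEVEN
  published names;
* `goodLatticeBDPValue_of_namedFacts₃₄` — the crux decl `Theses.EisensteinPrimes.GoodLatticeBDPValue` from the same seven names:
  `…₃₃ₙ stub_printInputs (p761499 h221 hI)`;
* `goodLatticeBDPValue_of_printInputs₇` — the same from ONE cite hypothesis `(… ∧ …) ∧ thm212 ∧ (proofThm221 ∧ thmI)` (the shape of -w2 gen 26's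
  LEAD restub draft), so that a v34 skeleton's composition is one call.

BY-NAME SURFACE after this file: **7 = research 7 · preprint-grade 0 · textbook 0** —
`CastellaGrossiLeeSkinner2022.proofThm422_exists_isBDPLFunction_isTorsion_charIdeal_dvd`, `….thm513_exists_isBDPLFunction_valueAtOne_disc`,
`BCGKPST2020.thm331_rubin_exists_katzMeasure₂_pseudoIso_span_eq`, `DeShalit1987.thmII64_katzMeasure₂_functionalEquation`,
`CastellaGrossiLeeSkinner2022.thm212_exists_isKatzLFunction`, `CastellaGrossiLeeSkinner2022.proofThm221_congruence_of_fullEisensteinDescent`,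
`Hida2010MuInvariant.thmI_mu_katzLFunction_eq_zero`.  No statement of the preprint arXiv:2402.12781 is an input any more: its Thm. 2.2.2
(`thm222_…_OPEN`, `…_of_fullDescentDatum`, `…_of_five_le`, `…_of_ne_one`) and, modulo the seven names, its Thm. 3.0.8 (`thm308_…_OPEN`) are OUTPUTS.

HONEST FRAMING: CONDITIONAL on exactly these seven names (audit `proof.conditional`); pure composition over landed theorems (0 definitions,
0 named facts, 0 sorry); closes nothing by itself; no summit statement / BSD / Mazur MC / IMC2 / theorem of CGLS, Hida, Kriz, Rubin, de Shalit or
Keller–Yin is proved here for any curve; 0 cells / labels / tiers move.  What the cell proved in the kernel is the REDUCTION, nothing beyond it.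
[cite: KellerYin2024, Thm. 3.0.8 (IMC2), Thm. 2.2.2 (arXiv:2402.12781v2 TeX L1618–L1640, L1445–1448) — statement shapes]
[cite: CastellaGrossiLeeSkinner2022, proof of Thm. 4.2.2, Thm. 5.1.3 with §2 (disc), Thm. 2.1.2, Thm. 2.2.1 and proof of Thm. 2.2.2 (arXiv:2008.02571v2 TeX L1051–1153)]
[cite: Hida2010MuInvariant, Thm. I (p. 45)] [cite: Kriz2016, Def. 31, Rem. 32, Rem. 33, Thm. 34 (2)–(3), Thm. 35] [cite: BleherEtAl2020, §3.3 Thm. 3.3.1]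
[cite: deShalit1987, II.6.4 Theorem (i)] [cite: Greenberg2016Selmer, Prop. 2.6.3 (c), Prop. 4.1.1] [cite: MilneADT2006, I Thm. 4.10 (a), I Thm. 5.1]
-/

noncomputable section

set_option autoImplicit false
set_option linter.dupNamespace false

namespace Summit.BirchSwinnertonDyer.BirchSwinnertonDyer.Theorems.GoodLatticeBDPValueOfNamedFactsV34

open NumberField Literature.NumberTheory.EllipticCurves Literature.NumberTheory.EllipticCurves.CastellaGrossiLeeSkinner2022 Literature.NumberTheory.EllipticCurves.BCGKPST2020
  Literature.NumberTheory.EllipticCurves.DeShalit1987 Literature.NumberTheory.EllipticCurves.KellerYin2024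
  Literature.NumberTheory.EllipticCurves.Hida2010MuInvariant

/-- **Keller–Yin Thm. 2.2.2 BY NAME — `KellerYin2024.thm222_anacong_goodLattice_OPEN` (the every-odd-`p` [AN] statement: at a good anomalous
Eisenstein prime, `μ = 0` and the `λ`-comparison for the good-lattice BDP `p`-adic `L`-function against the Katz `p`-adic `L`-function of the
quotient character) — from TWO PUBLISHED named facts**: CGLS 2022's proof of Thm. 2.2.1 from the Eisenstein congruence
(`proofThm221_congruence_of_fullEisensteinDescent`) and Hida 2010 Thm. I (`thmI_mu_katzLFunction_eq_zero`).  Width seat -w2 gen 26's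
`GoodLatticeAnacongOfCGLSProofOfDatum.thm222_anacong_goodLattice_of_fullDescentDatum_of_proofThm221_of_thmI` gives 3a-A (the statement AT a
full-descent datum); width seat w6 gen 8's `FullDescentDatumOddPrime.thm222_anacong_goodLattice_OPEN_of_fullDescentDatum` supplies the datum at every
odd good Eisenstein prime (Theorem A_p ∘ Theorem B_p, Ribet–Yoo necessity, kernel).  CONDITIONAL on the two names; nothing about their truth is
asserted. [cite: KellerYin2024, Thm. 2.2.2 (arXiv:2402.12781v2 TeX L1445–1448) — statement shape]
[cite: CastellaGrossiLeeSkinner2022, Thm. 2.2.1 and proof of Thm. 2.2.2 (arXiv:2008.02571v2 TeX L1051–1153)] [cite: Hida2010MuInvariant, Thm. I (p. 45)]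
[cite: Kriz2016, Def. 31, Rem. 32, Rem. 33, Thm. 34 (2)–(3), Thm. 35] -/
theorem thm222_anacong_goodLattice_OPEN_of_proofThm221_of_thmI
    (h221 : proofThm221_congruence_of_fullEisensteinDescent) (hI : thmI_mu_katzLFunction_eq_zero) :
    KellerYin2024.thm222_anacong_goodLattice_OPEN :=
  FullDescentDatumOddPrime.thm222_anacong_goodLattice_OPEN_of_fullDescentDatum
    (GoodLatticeAnacongOfCGLSProofOfDatum.thm222_anacong_goodLattice_of_fullDescentDatum_of_proofThm221_of_thmI h221 hI)

/-- **THE CRUX DECL BY NAME — `Theses.EisensteinPrimes.GoodLatticeBDPValue` — from SEVEN PUBLISHED named facts, NO preprint-grade input**: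
the v33N cite hypothesis `stub_printInputs` VERBATIM (CGLS 2022 proof of Thm. 4.2.2, Thm. 5.1.3 (disc); Bleher et al. 2020 Thm. 3.3.1; de Shalit
1987 II.6.4; CGLS 2022 Thm. 2.1.2 — five names, [CITE-ONLY — never a proof target, never benched]) and the two names behind 3a-A (CGLS 2022 proof
of Thm. 2.2.1 from the Eisenstein congruence; Hida 2010 Thm. I).  Body: LEAD g11's `…OfNamedFactsV33N.goodLatticeBDPValue_of_namedFacts₃₃ₙ` with its
content hypothesis 3a-A DISCHARGED by width seat -w2 gen 26's p761499.  CONDITIONAL on exactly these seven names; closes nothing by itself; BSD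
is proved for no curve. [cite: KellerYin2024, Thm. 3.0.8 (IMC2) — statement shape] [cite: CastellaGrossiLeeSkinner2022, proof of Thm. 4.2.2, Thm. 5.1.3 with (disc), Thm. 2.1.2, Thm. 2.2.1]
[cite: Hida2010MuInvariant, Thm. I] [cite: BleherEtAl2020, §3.3 Thm. 3.3.1] [cite: deShalit1987, II.6.4 Theorem (i)]
[cite: Greenberg2016Selmer, Prop. 2.6.3 (c), Prop. 4.1.1] [cite: MilneADT2006, I Thm. 4.10 (a), I Thm. 5.1] -/
theorem goodLatticeBDPValue_of_namedFacts₃₄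
    (stub_printInputs :
      (proofThm422_exists_isBDPLFunction_isTorsion_charIdeal_dvd ∧
        thm513_exists_isBDPLFunction_valueAtOne_disc ∧
        thm331_rubin_exists_katzMeasure₂_pseudoIso_span_eq ∧
        thmII64_katzMeasure₂_functionalEquation) ∧
      thm212_exists_isKatzLFunction)
    (h221 : proofThm221_congruence_of_fullEisensteinDescent) (hI : thmI_mu_katzLFunction_eq_zero) :
    Summit.BirchSwinnertonDyer.BirchSwinnertonDyer.Theses.EisensteinPrimes.GoodLatticeBDPValue :=
  GoodLatticeBDPValueOfNamedFactsV33N.goodLatticeBDPValue_of_namedFacts₃₃ₙ stub_printInputs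
    (GoodLatticeAnacongOfCGLSProofOfDatum.thm222_anacong_goodLattice_of_fullDescentDatum_of_proofThm221_of_thmI h221 hI)

/-- **The crux's SIGNATURE as a Literature `Prop` — `KellerYin2024.thm308_imc2_bdpValue_goodLattice_OPEN` (Keller–Yin Thm. 3.0.8 (IMC2) for the
good lattice at a good anomalous Eisenstein prime, read at `𝟙` and combined with the BDP formula [CGLS] Thm. 5.1.3) — from the SEVEN PUBLISHED named
facts.**  This is `goodLatticeBDPValue_of_namedFacts₃₄` with the route decl unfolded (`Theses.EisensteinPrimes.GoodLatticeBDPValue :=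
thm308_imc2_bdpValue_goodLattice_OPEN`, and likewise `Theses.RealTwistEisenstein.GoodLatticeBDPValue`, rank 9 of that route), stated on the
Literature name so that every route reading the `Prop` can cite one theorem.  CONDITIONAL on exactly these seven names; the `Prop` keeps its `_OPEN`
label (the label is the planner's to move); BSD is proved for no curve. [cite: KellerYin2024, Thm. 3.0.8 (IMC2) (arXiv:2402.12781v2 TeX L1618–L1640) — statement shape]
[cite: CastellaGrossiLeeSkinner2022, proof of Thm. 4.2.2, Thm. 5.1.3 with (disc), Thm. 2.1.2, Thm. 2.2.1] [cite: Hida2010MuInvariant, Thm. I]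
[cite: BleherEtAl2020, §3.3 Thm. 3.3.1] [cite: deShalit1987, II.6.4 Theorem (i)] -/
theorem thm308_imc2_bdpValue_goodLattice_OPEN_of_namedFacts₃₄
    (stub_printInputs :
      (proofThm422_exists_isBDPLFunction_isTorsion_charIdeal_dvd ∧
        thm513_exists_isBDPLFunction_valueAtOne_disc ∧
        thm331_rubin_exists_katzMeasure₂_pseudoIso_span_eq ∧
        thmII64_katzMeasure₂_functionalEquation) ∧
      thm212_exists_isKatzLFunction)
    (h221 : proofThm221_congruence_of_fullEisensteinDescent) (hI : thmI_mu_katzLFunction_eq_zero) :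
    KellerYin2024.thm308_imc2_bdpValue_goodLattice_OPEN :=
  goodLatticeBDPValue_of_namedFacts₃₄ stub_printInputs h221 hI

/-- **ONE-CALL FORM for a v34 skeleton — the crux decl from ONE cite hypothesis carrying all SEVEN published names**, in the shape of
width seat -w2 gen 26's LEAD restub draft (`HOME/line-x1-p1-w2-g26/halves-v34-draft-w2g26.lean`, `stub_printInputs :=
(proofThm422 ∧ thm513_disc ∧ thm331 ∧ thmII64) ∧ thm212 ∧ (proofThm221 ∧ thmI)`), so that a v34 composition is
`GoodLatticeBDPValueOfNamedFactsV34.goodLatticeBDPValue_of_printInputs₇ stub_printInputs` and the hypothesis coincides, name and type, with the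
registered cite stub [CITE-ONLY — never a proof target, never benched].  CONDITIONAL on exactly these seven names; closes nothing by itself;
BSD is proved for no curve. [cite: KellerYin2024, Thm. 3.0.8 (IMC2) — statement shape] [cite: CastellaGrossiLeeSkinner2022, proof of Thm. 4.2.2, Thm. 5.1.3 with (disc), Thm. 2.1.2, Thm. 2.2.1]
[cite: Hida2010MuInvariant, Thm. I] [cite: BleherEtAl2020, §3.3 Thm. 3.3.1] [cite: deShalit1987, II.6.4 Theorem (i)] -/
theorem goodLatticeBDPValue_of_printInputs₇
    (stub_printInputs :
      (proofThm422_exists_isBDPLFunction_isTorsion_charIdeal_dvd ∧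
        thm513_exists_isBDPLFunction_valueAtOne_disc ∧
        thm331_rubin_exists_katzMeasure₂_pseudoIso_span_eq ∧
        thmII64_katzMeasure₂_functionalEquation) ∧
      thm212_exists_isKatzLFunction ∧
      (proofThm221_congruence_of_fullEisensteinDescent ∧ thmI_mu_katzLFunction_eq_zero)) :
    Summit.BirchSwinnertonDyer.BirchSwinnertonDyer.Theses.EisensteinPrimes.GoodLatticeBDPValue :=
  goodLatticeBDPValue_of_namedFacts₃₄ ⟨stub_printInputs.1, stub_printInputs.2.1⟩ stub_printInputs.2.2.1 stub_printInputs.2.2.2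

end Summit.BirchSwinnertonDyer.BirchSwinnertonDyer.Theorems.GoodLatticeBDPValueOfNamedFactsV34

end
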